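import Literature.NumberTheory.DiophantineApproximation.PolylogHermitePade
import Literature.NumberTheory.DiophantineApproximation.DilogHermitePadeSeries
import HarnessLib

/-!
# The weight-`w` Hermite–Padé form at `x = 1/N` as `∑_{o<w} a_o Li_{o+1}(1/N) + a`

Topic `Literature/NumberTheory/DiophantineApproximation`. For the weight-`w` type-I Hermite–Padé
form `S^{(w)}_n(x) = ∑_{u ≥ 0} R^{(w)}_n(u) x^{u+1}` of `PolylogHermitePade.lean`
(`PolylogPade.formW`), a partial fraction expansion of the kernel at the naturals,
`R^{(w)}_n(u) = ∑_{p ≤ n} ∑_{o<w} c_{o,p}/(u+p+1)^{o+1}` (`BallRivoal.pfEval n w c u`; proved to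
exist in the sibling file `PolylogHermitePadeExpansion.lean`, here it is the HYPOTHESIS `hc`),
turns `S^{(w)}_n(1/N)` into `∑_{o<w} a_o L_{o+1} + a`, where `L_s = ∑_{k ≥ 1} N^{-k}/k^s`
(`DilogPade.polylogSeries s (1/N)`), `a_o = coefW n c N o = ∑_p c_{o,p} N^p` and
`a = constW n w c N = −∑_{o<w} ∑_{p≤n} c_{o,p} ∑_{1 ≤ m ≤ p} N^p/(N^m m^{o+1})`.

* `formW_eq_of_pfEval` — `S^{(w)}_n(1/N) = ∑_{o<w} (coefW n c N o) L_{o+1}(1/N) + constW n w c N`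
  for `N ≥ 2` (the every-weight analogue of `DilogPade.form_eq_of_partialFractions`).

The computation: `∑_{u ≥ 0} x^{u+1}/(u+1+p)^s = N^p (L_s − ∑_{k<p} x^{k+1}/(k+1)^s)` at `x = 1/N`
(`DilogPade.pow_mul_tsum_shift`, `x^p N^p = 1`), and in the finite remainder
`N^p x^{k+1}/(k+1)^s = N^p/(N^m m^s)` with `m = k + 1 ∈ [1, p]`.

References: S. David, N. Hirata-Kohno, M. Kawashima, *Can polylogarithms at algebraic points be
linearly independent?*, Moscow J. Comb. Number Th. 9 (2020), Thm 2.1; M. Hata, *On the linear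
independence of the values of polylogarithmic functions*, J. Math. Pures Appl. 69 (1990).
Everything here is PROVED from Mathlib's `tsum` API and `DilogHermitePadeSeries.lean`; no
definitions, no named facts.
-/

noncomputable section

open Finset

namespace Literature.NumberTheory.DiophantineApproximation

namespace PolylogPade

open Literature.NumberTheory.Transcendental

/-- Reindexing a sum over `Icc 1 p` by `m = k + 1`, `k < p`. [folklore] -/
private theorem sum_Icc_one_eq_sum_range_succ {M : Type*} [AddCommMonoid M] (f : ℕ → M) (p : ℕ) :
    ∑ m ∈ Icc 1 p, f m = ∑ k ∈ range p, f (k + 1) := by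
  rw [← Finset.Ico_add_one_right_eq_Icc, Finset.sum_Ico_eq_sum_range, Nat.add_sub_cancel]
  refine Finset.sum_congr rfl fun k _ => ?_
  rw [add_comm]

/-- **The weight-`w` Hermite–Padé form at `x = 1/N`** (David–Hirata-Kohno–Kawashima 2020, the
computation behind Thm 2.1; Hata 1990; Nikišin 1979). If the kernel has the partial fraction
expansion `R^{(w)}_n(u) = ∑_{p ≤ n} ∑_{o<w} c_{o,p}/(u+p+1)^{o+1}` at the naturals `u`
(`BallRivoal.pfEval n w c u`), then for every integer `N ≥ 2`
`S^{(w)}_n(1/N) = ∑_{o<w} a_o · L_{o+1}(1/N) + a`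
with `a_o = coefW n c N o = ∑_p c_{o,p} N^p`, `a = constW n w c N` and `L_s = polylogSeries s`.
[cite: DavidHirataKohnoKawashima2020, Thm 2.1] -/
theorem formW_eq_of_pfEval {w n N : ℕ} (hN : 2 ≤ N) (c : ℕ → ℕ → ℚ)
    (hc : ∀ u : ℕ, kernelW w n u = BallRivoal.pfEval n w c u) :
    formW w n (1 / (N : ℝ)) =
      (∑ o ∈ Finset.range w,
          ((coefW n c N o : ℚ) : ℝ) * DilogPade.polylogSeries (o + 1) (1 / (N : ℝ))) +
        ((constW n w c N : ℚ) : ℝ) := by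
  have hNpos : (0 : ℝ) < N := Nat.cast_pos.mpr (by omega)
  have hN0 : (N : ℝ) ≠ 0 := hNpos.ne'
  set x : ℝ := 1 / (N : ℝ) with hx
  have hx0 : 0 ≤ x := by positivity
  have hx1 : x < 1 := by
    rw [hx, div_lt_one hNpos]
    exact_mod_cast (by omega : 1 < N)
  have hNx : ∀ j : ℕ, (N : ℝ) ^ j * x ^ j = 1 := fun j => by
    rw [← mul_pow, hx, mul_one_div_cancel hN0, one_pow]
  -- summability of the shifted series and the shift identity solved for the shifted series
  have hS : ∀ s i : ℕ, Summable fun t : ℕ => x ^ (t + 1) / ((t : ℝ) + 1 + i) ^ s :=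
    fun s i => DilogPade.summable_pow_div_shift s i hx0 hx1
  have hg : ∀ s i : ℕ, ∑' t : ℕ, x ^ (t + 1) / ((t : ℝ) + 1 + i) ^ s =
      (N : ℝ) ^ i * (DilogPade.polylogSeries s x -
        ∑ k ∈ range i, x ^ (k + 1) / ((k : ℝ) + 1) ^ s) := by
    intro s i
    rw [← DilogPade.pow_mul_tsum_shift s i hx0 hx1, ← mul_assoc, hNx, one_mul]
  -- Step 1: expand the kernel by `hc` (cast from `ℚ` to `ℝ`) and exchange `tsum` and finite sums.
  have hterm : ∀ u : ℕ, (kernelW w n u : ℝ) * x ^ (u + 1) =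
      ∑ p ∈ range (n + 1), ∑ o ∈ range w,
        (c o p : ℝ) * (x ^ (u + 1) / ((u : ℝ) + 1 + p) ^ (o + 1)) := by
    intro u
    have hcu : (kernelW w n u : ℝ) =
        ∑ p ∈ range (n + 1), ∑ o ∈ range w, (c o p : ℝ) / ((u : ℝ) + 1 + p) ^ (o + 1) := by
      rw [hc u]
      push_cast [BallRivoal.pfEval]
      refine Finset.sum_congr rfl fun p _ => Finset.sum_congr rfl fun o _ => ?_
      rw [add_right_comm (u : ℝ) 1 (p : ℝ)]
    rw [hcu, Finset.sum_mul]
    refine Finset.sum_congr rfl fun p _ => ?_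
    rw [Finset.sum_mul]
    refine Finset.sum_congr rfl fun o _ => ?_
    ring
  have h1 : formW w n x = ∑ p ∈ range (n + 1), ∑ o ∈ range w,
      (c o p : ℝ) * ∑' u : ℕ, x ^ (u + 1) / ((u : ℝ) + 1 + p) ^ (o + 1) := by
    rw [formW, tsum_congr hterm, Summable.tsum_finsetSum fun p _ =>
      summable_sum fun o _ => (hS (o + 1) p).mul_left (c o p : ℝ)]
    refine Finset.sum_congr rfl fun p _ => ?_
    rw [Summable.tsum_finsetSum fun o _ => (hS (o + 1) p).mul_left (c o p : ℝ)]
    refine Finset.sum_congr rfl fun o _ => ?_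
    exact tsum_mul_left
  -- Step 2: the finite remainders at `x = 1/N`: `N^p x^{k+1}/(k+1)^{o+1} = N^p/(N^m m^{o+1})`
  -- with `m = k + 1 ∈ Icc 1 p`.
  have hfin : ∀ p o : ℕ, (N : ℝ) ^ p * ∑ k ∈ range p, x ^ (k + 1) / ((k : ℝ) + 1) ^ (o + 1) =
      ∑ m ∈ Icc 1 p, (N : ℝ) ^ p / ((N : ℝ) ^ m * (m : ℝ) ^ (o + 1)) := by
    intro p o
    rw [sum_Icc_one_eq_sum_range_succ, Finset.mul_sum]
    refine Finset.sum_congr rfl fun k _ => ?_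
    push_cast
    rw [hx, one_div_pow, div_div, mul_one_div]
  have h2 : formW w n x = ∑ p ∈ range (n + 1), ∑ o ∈ range w,
      ((c o p : ℝ) * (N : ℝ) ^ p * DilogPade.polylogSeries (o + 1) x -
        (c o p : ℝ) * ∑ m ∈ Icc 1 p, (N : ℝ) ^ p / ((N : ℝ) ^ m * (m : ℝ) ^ (o + 1))) := by
    rw [h1]
    refine Finset.sum_congr rfl fun p _ => Finset.sum_congr rfl fun o _ => ?_
    rw [hg, ← hfin]
    ring
  -- Step 3: swap the two finite sums and identify the coefficients.
  have hA : ∀ o : ℕ, ((coefW n c N o : ℚ) : ℝ) * DilogPade.polylogSeries (o + 1) x =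
      ∑ p ∈ range (n + 1), (c o p : ℝ) * (N : ℝ) ^ p * DilogPade.polylogSeries (o + 1) x := by
    intro o
    push_cast [coefW]
    rw [Finset.sum_mul]
  have hC : ((constW n w c N : ℚ) : ℝ) = -∑ o ∈ range w, ∑ p ∈ range (n + 1),
      (c o p : ℝ) * ∑ m ∈ Icc 1 p, (N : ℝ) ^ p / ((N : ℝ) ^ m * (m : ℝ) ^ (o + 1)) := by
    push_cast [constW]
    rfl
  rw [h2, Finset.sum_comm]
  simp only [Finset.sum_sub_distrib]
  simp_rw [hA]
  rw [hC]
  ring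

end PolylogPade

end Literature.NumberTheory.DiophantineApproximation
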